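import Summits.HodgeConjecture.HodgeConjecture.Theorems.H413FinAdelicEulerFactorisation
import HarnessLib

/-!
# P4 ∕ E-2: INTEGRABILITY over `U(J)(𝔸_{F,f}) = ∏'_v U(J)(F_v)` of a pure-tensor integrand with bounded Euler product of local `L¹` norms
# (the `Integrable` sibling of ★ `ThetaNonvanishing.exists_integral_finAdelic_eq_tprod`)

Topic: summit `HodgeConjecture`, sub-problem `HodgeConjecture`, crux H413 (stmt-HodgeConjecture-24833), FLOOR 0, P4 ∕ ENGINE E-2 (Siegel–Weil, rank one), road C
brick C-γ (orbital sums: «`∫_{U(J₁)(𝔸_f)} ‖⟨finPairRep(1,b)Φ_f, Φ'_f⟩‖ db < ∞` for pure tensors», F0P2a-p06 (g5)); named as the missing wrapper by the E-2 lead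
F0P4-p02 (g3) 2026-08-31T01:44:47Z (4); F0P4-plan (g3) word 01:55:24Z (n2a).  Author F0P4-p04 (g3).  Namespace
`Summit.HodgeConjecture.HodgeConjecture.Cruxes.H413.ThetaNonvanishing`.  KERNEL: theorems only, `--supports stmt-HodgeConjecture-24833 --as helper`.

★ `exists_integral_finAdelic_eq_tprod` (`Theorems/H413FinAdelicEulerFactorisation`, F0P4-p07 (g0)) exports only the VALUE `∫ f dμ_f = ∏'_v ∫ f_v` of the restricted
direct integration of a pure tensor (Leahy Prop. 3.1.8–3.1.9 ∕ Tate Thm 3.3.1 through the HodgeCM∕PerL34 kernel engine ★ `RestrictedProductMeasureDatum`, transported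
along ★ `UnitaryGroup.finAdelicEquiv : U(J)(𝔸_{F,f}) ≃ₜ* Πʳ_v [U(J)(F_v), U(J)(𝒪_v)]`).  The same engine proves INTEGRABILITY (★ `RestrictedProductMeasureDatum.integrable`
= Leahy 3.1.9 (ii), last clause); this file exports it for the same carrier with the SAME binders, so a consumer holding the four rows of the ★ value theorem
(pure tensor off `T`, a.e.-strong measurability, integrable local factors, bounded partial products of `∫‖f_v‖`) gets `Integrable f μ_f` by `exact`:

* **`integrable_finAdelic_of_pureTensor`** — `Integrable f μ_f` (no normalising constant: integrability is scale-free);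
* `integrable_norm_finAdelic_of_pureTensor` — the same for `b ↦ ‖f b‖` (the shape C-γ letters: `∫ ‖⟨ω(1,b)Φ_f, Φ'_f⟩‖ db < ∞`), read as `Integrable`;
* `lintegral_enorm_finAdelic_lt_top_of_pureTensor` — the `∫⁻ ‖f‖ₑ < ∞` spelling.

HC_CM is proved only modulo the printed citations until rung 0 closes; this file proves nothing printed.

## References
* [Li1992] J.-S. Li, J. reine angew. Math. 428 (1992), Thm 2.1 (27) p. 184 (Euler product of the finite-adelic coefficient integral).
* [TateThesis1967] J. Tate, in Cassels–Fröhlich (1967), Thm 3.3.1 (restricted direct integration).  [PlatonovRapinchuk1994] §5.1.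
* Tree (★): `Theorems/H413FinAdelicEulerFactorisation` (`exists_integral_finAdelic_eq_tprod`, `locallyCompactSpace_localPi`, `secondCountableTopology_localPi`),
  `HodgeCM/PerL34/AdelicFactorisation` (`RestrictedProductMeasureDatum.integrable`, `.ofLeftInvariant`), `Automorphic/UnitaryGroupRestrictedProduct` (`finAdelicEquiv`).
-/

set_option autoImplicit false
set_option linter.dupNamespace false

noncomputable section

open _root_.MeasureTheory NumberField IsDedekindDomain Topology
open scoped RestrictedProduct NNReal ENNReal Classical
open Literature.NumberTheory.Automorphic
open HodgeCM.PerL34 HodgeCM.PerL34.AdelicFactorisation HodgeCM.PerL34.AdelicFactorisation.RestrictedProductMeasureDatum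

namespace Summit.HodgeConjecture.HodgeConjecture.Cruxes.H413.ThetaNonvanishing

variable (F E : Type) [Field F] [NumberField F] [Field E] [NumberField E] [Algebra F E]
  (c : E ≃ₐ[F] E) (N : ℕ) (J : Matrix (Fin N) (Fin N) E)

section Datum

variable [∀ v : HeightOneSpectrum (𝓞 F), MeasurableSpace (UnitaryGroup.localPi E c N J v)]
  [∀ v : HeightOneSpectrum (𝓞 F), BorelSpace (UnitaryGroup.localPi E c N J v)]
  [MeasurableSpace (UnitaryGroup.finAdelic F E c N J)] [BorelSpace (UnitaryGroup.finAdelic F E c N J)]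
  (μf : Measure (UnitaryGroup.finAdelic F E c N J)) [μf.IsHaarMeasure]
  (ν : ∀ v : HeightOneSpectrum (𝓞 F), Measure (UnitaryGroup.localPi E c N J v))
  [∀ v, (ν v).IsHaarMeasure] [∀ v, SigmaFinite (ν v)]
  (S₀ : Finset (HeightOneSpectrum (𝓞 F))) {i₀ : HeightOneSpectrum (𝓞 F)} (hi₀ : i₀ ∈ S₀)
  (hB1 : ∀ v, v ∉ S₀ → ν v (UnitaryGroup.localInt E c N J v : Set (UnitaryGroup.localPi E c N J v)) = 1)

include hi₀ hB1 in
/-- **INTEGRABILITY of a pure tensor over `U(J)(𝔸_{F,f}) = Πʳ_v [U(J)(F_v), U(J)(𝒪_v)]`** (Leahy 3.1.9 (ii) through ★ `RestrictedProductMeasureDatum.integrable`,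
transported along ★ `UnitaryGroup.finAdelicEquiv`), with the SAME binders as ★ `exists_integral_finAdelic_eq_tprod`: `μ_f` any Haar measure on `U(J)(𝔸_{F,f})`,
`ν_v` local Haar measures with `ν_v(U(J)(𝒪_v)) = 1` off a finite `S₀ ∋ i₀`, `f` a PURE TENSOR off `T` (on every principal level `S ⊇ T`,
`f(e⁻¹(glue_S(x, k))) = ∏_{v∈S} f_v(x_v)`), a.e.-strongly measurable, with integrable local factors and bounded partial products of `∫‖f_v‖`.  Then
`Integrable f μ_f`. [cite: TateThesis1967, Thm 3.3.1] [cite: Li1992, Thm 2.1 (27) p. 184] [cite: PlatonovRapinchuk1994, §5.1] -/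
theorem integrable_finAdelic_of_pureTensor {f : UnitaryGroup.finAdelic F E c N J → ℂ} {fl : ∀ v, UnitaryGroup.localPi E c N J v → ℂ}
    {T : Finset (HeightOneSpectrum (𝓞 F))}
    (hpure : ∀ S : Finset (HeightOneSpectrum (𝓞 F)), T ⊆ S →
      ∀ x : ((v : ↥S) → UnitaryGroup.localPi E c N J v) ×
          ((v : {v // v ∉ S}) → (UnitaryGroup.localInt E c N J v : Set (UnitaryGroup.localPi E c N J v))),
        f ((UnitaryGroup.finAdelicEquiv F E c N J).symm
          (RestrictedMeasure.glue (fun v => (UnitaryGroup.localInt E c N J v : Set (UnitaryGroup.localPi E c N J v))) S x)) =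
          ∏ v : ↥S, fl v.1 (x.1 v))
    (hfm : AEStronglyMeasurable f μf) (hfl : ∀ v, Integrable (fl v) (ν v))
    (hB : ∃ B : ℝ, ∀ S : Finset (HeightOneSpectrum (𝓞 F)), S₀ ⊆ S → T ⊆ S → ∏ v ∈ S, ∫ x, ‖fl v x‖ ∂ν v ≤ B) :
    Integrable f μf := by
  haveI : Countable (HeightOneSpectrum (𝓞 F)) := countable_heightOneSpectrum F
  haveI : ∀ v, LocallyCompactSpace (UnitaryGroup.localPi E c N J v) := fun v => locallyCompactSpace_localPi F E c N J v
  haveI : ∀ v, SecondCountableTopology (UnitaryGroup.localPi E c N J v) :=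
    fun v => secondCountableTopology_localPi F E c N J v
  have hKo : ∀ v : HeightOneSpectrum (𝓞 F), IsOpen (UnitaryGroup.localInt E c N J v : Set (UnitaryGroup.localPi E c N J v)) :=
    Fact.out
  have hKm : ∀ v, MeasurableSet (UnitaryGroup.localInt E c N J v : Set (UnitaryGroup.localPi E c N J v)) :=
    fun v => (hKo v).measurableSet
  haveI := RestrictedMeasure.borelSpace
    (K := fun v => (UnitaryGroup.localInt E c N J v : Set (UnitaryGroup.localPi E c N J v))) hKm
  -- the transported Haar measure `μ' = e_* μ_f` is σ-finite and left invariant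
  haveI := UnitaryGroup.locallyCompactSpace_finAdelic F E c N J
  haveI := UnitaryGroup.secondCountableTopology_finAdelic F E c N J
  haveI : SigmaCompactSpace (UnitaryGroup.finAdelic F E c N J) := sigmaCompactSpace_of_locallyCompact_secondCountable
  haveI : SigmaFinite μf := inferInstance
  set e := UnitaryGroup.finAdelicEquiv F E c N J with he
  have hcoe : (e.toHomeomorph.toMeasurableEquiv : UnitaryGroup.finAdelic F E c N J → _) = e := Homeomorph.toMeasurableEquiv_coe _
  haveI : SigmaFinite (μf.map e) := by
    rw [← hcoe]; exact e.toHomeomorph.toMeasurableEquiv.sigmaFinite_map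
  haveI hHaar : (μf.map e).IsHaarMeasure := e.toMulEquiv.isHaarMeasure_map μf e.continuous e.symm.continuous
  let C : ∀ v : HeightOneSpectrum (𝓞 F), TopologicalSpace.PositiveCompacts (UnitaryGroup.localPi E c N J v) := fun v =>
    { carrier := (UnitaryGroup.localInt E c N J v : Set (UnitaryGroup.localPi E c N J v))
      isCompact' := UnitaryGroup.isCompact_localInt E c N J v
      interior_nonempty' := ⟨1, by rw [(hKo v).interior_eq]; exact one_mem _⟩ }
  -- the datum: measure `e_* μ_f`, exceptional set `S₀`, levels = glue, local measures `ν` rescaled at `i₀`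
  let D := RestrictedProductMeasureDatum.ofLeftInvariant (fun v => UnitaryGroup.localInt E c N J v) S₀ C ν
      (fun v _ => UnitaryGroup.isCompact_localInt E c N J v) hB1 hi₀ (μf.map e)
  set κ : ℝ≥0 := RestrictedMeasure.haarScalar (fun v => UnitaryGroup.localInt E c N J v) S₀ C ν (μf.map e) with hκ
  have hDμ : D.μ = μf.map e := rfl
  have hDν : D.ν = Function.update ν i₀ (κ • ν i₀) := rfl
  -- the four rows, transported to the datum
  have hfm' : AEStronglyMeasurable (f ∘ e.symm) (μf.map e) := by
    rw [← hcoe, (e.toHomeomorph.toMeasurableEquiv.measurableEmbedding).aestronglyMeasurable_map_iff]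
    have hcomp : (f ∘ ⇑e.symm) ∘ ⇑(e.toHomeomorph.toMeasurableEquiv) = f := by
      funext b
      simp only [Function.comp_apply, hcoe, ContinuousMulEquiv.symm_apply_apply]
    rw [hcomp]
    exact hfm
  have hpure' : D.IsPureTensor T (f ∘ e.symm) fl := fun S hS x => hpure S hS x
  have hfl' : ∀ v, Integrable (fl v) (D.ν v) := by
    intro v
    rw [hDν]
    by_cases hv : v = i₀
    · subst hv
      rw [Function.update_self]
      exact (hfl v).smul_measure ENNReal.coe_ne_top
    · rw [Function.update_of_ne hv]
      exact hfl v
  have hB' : ∃ B : ℝ, ∀ S : Finset (HeightOneSpectrum (𝓞 F)), D.S₀ ⊆ S → T ⊆ S →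
      ∏ v ∈ S, ∫ x, ‖fl v x‖ ∂D.ν v ≤ B := by
    obtain ⟨B, hB⟩ := hB
    refine ⟨(κ : ℝ) * B, fun S hS hT => ?_⟩
    have hi : i₀ ∈ S := hS hi₀
    have herase : ∏ v ∈ S.erase i₀, ∫ x, ‖fl v x‖ ∂(Function.update ν i₀ (κ • ν i₀) v) =
        ∏ v ∈ S.erase i₀, ∫ x, ‖fl v x‖ ∂ν v :=
      Finset.prod_congr rfl fun v hv => by rw [Function.update_of_ne (Finset.ne_of_mem_erase hv)]
    rw [hDν, ← Finset.mul_prod_erase S _ hi, Function.update_self, integral_smul_nnreal_measure, herase, NNReal.smul_def,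
      smul_eq_mul, mul_assoc, Finset.mul_prod_erase S (fun v => ∫ x, ‖fl v x‖ ∂ν v) hi]
    exact mul_le_mul_of_nonneg_left (hB S hS hT) κ.coe_nonneg
  -- Leahy 3.1.9 (ii) on the datum, transported back along `e`
  have hint : Integrable (f ∘ e.symm) (μf.map e) := by
    have h := RestrictedProductMeasureDatum.integrable hpure' hfm' hfl' hB'
    rwa [hDμ] at h
  rw [← hcoe] at hint
  have hback := (integrable_map_equiv e.toHomeomorph.toMeasurableEquiv (f ∘ e.symm)).mp hint
  have hcomp : (f ∘ ⇑e.symm) ∘ ⇑(e.toHomeomorph.toMeasurableEquiv) = f := by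
    funext b
    simp only [Function.comp_apply, hcoe, ContinuousMulEquiv.symm_apply_apply]
  rwa [hcomp] at hback

include hi₀ hB1 in
/-- the same, read for the norm `b ↦ ‖f b‖` (the shape road C brick C-γ letters: `∫ ‖⟨ω(1,b)Φ_f, Φ'_f⟩‖ db < ∞` as `Integrable`).
[cite: TateThesis1967, Thm 3.3.1] [cite: Li1992, Thm 2.1 (27) p. 184] -/
theorem integrable_norm_finAdelic_of_pureTensor {f : UnitaryGroup.finAdelic F E c N J → ℂ} {fl : ∀ v, UnitaryGroup.localPi E c N J v → ℂ}
    {T : Finset (HeightOneSpectrum (𝓞 F))}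
    (hpure : ∀ S : Finset (HeightOneSpectrum (𝓞 F)), T ⊆ S →
      ∀ x : ((v : ↥S) → UnitaryGroup.localPi E c N J v) ×
          ((v : {v // v ∉ S}) → (UnitaryGroup.localInt E c N J v : Set (UnitaryGroup.localPi E c N J v))),
        f ((UnitaryGroup.finAdelicEquiv F E c N J).symm
          (RestrictedMeasure.glue (fun v => (UnitaryGroup.localInt E c N J v : Set (UnitaryGroup.localPi E c N J v))) S x)) =
          ∏ v : ↥S, fl v.1 (x.1 v))
    (hfm : AEStronglyMeasurable f μf) (hfl : ∀ v, Integrable (fl v) (ν v))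
    (hB : ∃ B : ℝ, ∀ S : Finset (HeightOneSpectrum (𝓞 F)), S₀ ⊆ S → T ⊆ S → ∏ v ∈ S, ∫ x, ‖fl v x‖ ∂ν v ≤ B) :
    Integrable (fun b => ‖f b‖) μf :=
  (integrable_finAdelic_of_pureTensor F E c N J μf ν S₀ hi₀ hB1 hpure hfm hfl hB).norm

include hi₀ hB1 in
/-- the same, in the `∫⁻ ‖f‖ₑ < ∞` spelling. [cite: TateThesis1967, Thm 3.3.1] -/
theorem lintegral_enorm_finAdelic_lt_top_of_pureTensor {f : UnitaryGroup.finAdelic F E c N J → ℂ}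
    {fl : ∀ v, UnitaryGroup.localPi E c N J v → ℂ} {T : Finset (HeightOneSpectrum (𝓞 F))}
    (hpure : ∀ S : Finset (HeightOneSpectrum (𝓞 F)), T ⊆ S →
      ∀ x : ((v : ↥S) → UnitaryGroup.localPi E c N J v) ×
          ((v : {v // v ∉ S}) → (UnitaryGroup.localInt E c N J v : Set (UnitaryGroup.localPi E c N J v))),
        f ((UnitaryGroup.finAdelicEquiv F E c N J).symm
          (RestrictedMeasure.glue (fun v => (UnitaryGroup.localInt E c N J v : Set (UnitaryGroup.localPi E c N J v))) S x)) =
          ∏ v : ↥S, fl v.1 (x.1 v))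
    (hfm : AEStronglyMeasurable f μf) (hfl : ∀ v, Integrable (fl v) (ν v))
    (hB : ∃ B : ℝ, ∀ S : Finset (HeightOneSpectrum (𝓞 F)), S₀ ⊆ S → T ⊆ S → ∏ v ∈ S, ∫ x, ‖fl v x‖ ∂ν v ≤ B) :
    ∫⁻ b, ‖f b‖ₑ ∂μf < ∞ :=
  (integrable_finAdelic_of_pureTensor F E c N J μf ν S₀ hi₀ hB1 hpure hfm hfl hB).hasFiniteIntegral

end Datum

end Summit.HodgeConjecture.HodgeConjecture.Cruxes.H413.ThetaNonvanishing

end
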